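import Literature.NumberTheory.EllipticCurves.CyclotomicLineCocycleCountProofs
import Literature.NumberTheory.EllipticCurves.CyclotomicLineFrobeniusScalarProofs
import Literature.NumberTheory.EllipticCurves.TateModuleReductionKernelProofs
import Literature.NumberTheory.EllipticCurves.IwasawaSelmerControlLocalInputsProofs
import HarnessLib

/-!
# The cocycle count (C1) at a good ordinary prime from a Frobenius fixing `μ_{p^∞}`

`Proofs` file (theorems only: no definition, no named fact) in topic `NumberTheory/EllipticCurves`;
part of the elementary proof of Greenberg's Lemma 3.4 at the layer `n = 0` (R. Greenberg,
*Iwasawa theory for elliptic curves*, LNM 1716 (1999), §3 Lemma 3.4, p. 89; §2 Prop. 2.2, p. 73),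
feeding hypothesis (C1) of `ResKernel.finite_primary_subgroupResKer_of_reduction`
(`IwasawaLocalKummerSkeletonProofs`). The reduction map enters only through an abstract additive
map `red₀ : E(K̄_v) → B` ("`E(K̄_v) → Ẽ(k̄_v)`") with the three properties of the ordinary
filtration (`OrdinaryReductionKernelTorsionProofs`): `ker red₀ ∩ E[p^r]` is cyclic of order `p^r`
with a generator, `red₀` maps `E[p^r]` onto `B[p^r]`, and — for an arithmetic Frobenius `τ`
fixing every `p`-power root of unity of `K̄_v` (`CyclotomicTowerLocalFrobeniusProofs`) — the
reductions `red₀ Q` with `red₀ (τQ) = red₀ Q` lie in a fixed finite set `SF` ("`Ẽ(k_v)`",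
`GaloisConjugateReductionLayerProofs`).

* `WeierstrassCurve.card_filter_smul_nsmul_eq_le` — **the `τ`-fixed part of the cyclotomic line
  is bounded by `#SF`**: for `P₀ ∈ ker red₀` of order `p^k`, the number of `i < p^k` with
  `τ(iP₀) = iP₀` is at most `#SF`. (The `τ`-fixed elements of `ker red₀ ∩ E[p^k]` form a subgroup
  of the cyclic group `ℤP₀`, of order `p^j`; it is `ker red₀ ∩ E[p^j]`, whose generator is then
  `τ`-fixed, so by the Weil-pairing scalar lemma `localPoints_exists_nsmul_smul_sub_eq_nsmul`
  (`φψ = χ` read at `χ(τ) = 1`) `τ` moves every `p^j`-torsion point inside `ker red₀`; hence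
  `B[p^j] = red₀(E[p^j]) ⊆ SF` and `p^j = #B[p^j] ≤ #SF`.) This is the finiteness
  `#Ẽ(𝔽_p)(p) < ∞` in Greenberg's `#ker(r_v) = #Ẽ(𝔽_p)(p)²` (p. 89), in the form needed to bound
  the two constants `N` and `M₀` of `exists_finset_cocycle_reps_of_cyclotomicLine` uniformly in `k`.
* `WeierstrassCurve.exists_finset_cocycle_reps_of_ordinaryLine` — **(C1)**: for every `k` the
  continuous cocycles `Γ_{K_v} → ker red₀ ∩ E[p^k]` fall into at most `#SF² · q · q^k` classes
  modulo coboundaries of `p^k`-torsion points (`q = #k_v`), by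
  `exists_finset_cocycle_reps_of_cyclotomicLine` with the Frobenius `τ` (`a = 1`,
  `e ≡ b⁻¹`), the cyclotomic line `localPoints_exists_isPrimitiveRoot_smul_eq_pow` over a
  Teichmüller layer `K_v(ζ_{q^f-1})` on which the reductions of lifts of `B[p^k]` are fixed
  (hypothesis `hlayer`), and the bound above.

## References

* [GreenbergLNM1716] R. Greenberg, *Iwasawa theory for elliptic curves*, LNM 1716 (1999), §2
  Prop. 2.2 (p. 73) and p. 70, §3 Lemma 3.4 (p. 89).
* [SilvermanAEC2009] J. H. Silverman, *The Arithmetic of Elliptic Curves*, III.8.1, VII.2.1.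
-/

noncomputable section

open scoped Classical NNReal AddSubgroup
open NumberField IsDedekindDomain

universe u

namespace WeierstrassCurve

open Literature.NumberTheory.EllipticCurves Literature.NumberTheory.GaloisRepresentations Field

/-! ## The `τ`-fixed part of the cyclotomic line -/

section Fixed

variable {K : Type u} [Field K] (W : WeierstrassCurve K) [W.IsElliptic]
  (E : Type u) [Field E] [Algebra K E] [CharZero E] {p : ℕ} [hp : Fact p.Prime]
  {B : Type*} [AddCommGroup B]

set_option maxHeartbeats 800000 in
/-- **The `τ`-fixed multiples of a generator of `ker red₀ ∩ E[p^k]` number at most `#SF`.** Let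
`red₀ : E(K̄_E) → B` be additive with `ker red₀ ∩ E[p^r]` cyclic of order `p^r` on a generator
(`hgenr`) and `red₀(E[p^r]) = B[p^r]` (`hsurj`) for all `r`; let `τ ∈ Γ_E` fix every `p`-power
root of unity and let `SF ⊆ B` contain every `red₀ Q` with `red₀ (τQ) = red₀ Q`. Then for
`P₀ ∈ ker red₀` of order `p^k`, `#{i < p^k : τ(iP₀) = iP₀} ≤ #SF`: the `τ`-fixed elements of
`ker red₀ ∩ E[p^k] = ℤP₀` form a subgroup of order `p^j` killed by `p^j`, hence equal to
`ker red₀ ∩ E[p^j]`, whose generator `P₁` is `τ`-fixed; the Weil-pairing scalar lemma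
(`localPoints_exists_nsmul_smul_sub_eq_nsmul` with `b = 1`) gives `τQ - Q ∈ ℤP₁ ⊆ ker red₀` for
all `Q ∈ E[p^j]`, so `B[p^j] ⊆ SF`, and `#B[p^j] = #E[p^j]/#(ker red₀ ∩ E[p^j]) = p^j`.
Greenberg, LNM 1716, §2 p. 70 (`Ẽ(f)_p` is finite; `φψ = χ` on the ordinary filtration) and §3
Lemma 3.4 (p. 89). [cite: GreenbergLNM1716, §3 Lemma 3.4 (p. 89)]
[cite: SilvermanAEC2009, Prop. III.8.1] -/
theorem card_filter_smul_nsmul_eq_le (red₀ : localPoints W E →+ B)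
    {τ : absoluteGaloisGroup E}
    (hτfix : ∀ (k : ℕ) (ξ : AlgebraicClosure E), ξ ^ p ^ k = 1 → τ • ξ = ξ)
    (hgenr : ∀ r : ℕ, ∃ P₁ : localPoints W E, red₀ P₁ = 0 ∧ addOrderOf P₁ = p ^ r ∧
      ∀ P : localPoints W E, red₀ P = 0 → ((p ^ r : ℕ) : ℤ) • P = 0 → ∃ c : ℕ, P = c • P₁)
    (hsurj : ∀ (r : ℕ) (y : B), ((p ^ r : ℕ) : ℤ) • y = 0 →
      ∃ x : localPoints W E, ((p ^ r : ℕ) : ℤ) • x = 0 ∧ red₀ x = y)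
    (SF : Finset B) (hSF : ∀ Q : localPoints W E, red₀ (τ • Q) = red₀ Q → red₀ Q ∈ SF)
    {k : ℕ} {P₀ : localPoints W E} (hP₀ : red₀ P₀ = 0) (hordP₀ : addOrderOf P₀ = p ^ k) :
    ((Finset.range (p ^ k)).filter fun i : ℕ ↦ τ • (i • P₀) = i • P₀).card ≤ SF.card := by
  have hpr : ∀ r : ℕ, p ^ r ≠ 0 := fun r ↦ pow_ne_zero r hp.out.ne_zero
  have hpkP₀ : (p ^ k) • P₀ = 0 := by rw [← hordP₀]; exact addOrderOf_nsmul_eq_zero P₀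
  -- the subgroups `C r = ker red₀ ∩ E[p^r]`, cyclic of order `p^r`
  let C : ℕ → AddSubgroup (localPoints W E) := fun r ↦
    red₀.ker ⊓ AddSubgroup.torsionBy (localPoints W E) ((p ^ r : ℕ) : ℤ)
  have hmemC : ∀ (r : ℕ) (Q : localPoints W E),
      Q ∈ C r ↔ red₀ Q = 0 ∧ ((p ^ r : ℕ) : ℤ) • Q = 0 := fun r Q ↦ by
    change Q ∈ red₀.ker ⊓ AddSubgroup.torsionBy (localPoints W E) ((p ^ r : ℕ) : ℤ) ↔ _
    rw [AddSubgroup.mem_inf, AddMonoidHom.mem_ker, mem_torsionBy_iff]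
  have hC : ∀ r : ℕ, ∃ P₁ ∈ C r, addOrderOf P₁ = p ^ r ∧ C r = AddSubgroup.zmultiples P₁ := by
    intro r
    obtain ⟨P₁, hP₁, hord₁, hgen₁⟩ := hgenr r
    have hP₁C : P₁ ∈ C r := (hmemC r P₁).mpr ⟨hP₁, by
      rw [natCast_zsmul, ← hord₁, addOrderOf_nsmul_eq_zero]⟩
    refine ⟨P₁, hP₁C, hord₁, le_antisymm ?_ (AddSubgroup.zmultiples_le.mpr hP₁C)⟩
    intro Q hQ
    obtain ⟨c, rfl⟩ := hgen₁ Q ((hmemC r Q).mp hQ).1 ((hmemC r Q).mp hQ).2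
    exact AddSubgroup.mem_zmultiples_iff.mpr ⟨c, natCast_zsmul P₁ c⟩
  have hcardC : ∀ r : ℕ, Nat.card (C r) = p ^ r := fun r ↦ by
    obtain ⟨P₁, -, hord₁, hCeq⟩ := hC r
    rw [hCeq, Nat.card_zmultiples, hord₁]
  have hfinC : ∀ r : ℕ, Finite (C r) := fun r ↦
    Nat.finite_of_card_ne_zero (by rw [hcardC]; exact hpr r)
  -- the subgroup `D` of `τ`-fixed elements of `C k`
  let D : AddSubgroup (localPoints W E) :=
    { carrier := {Q | Q ∈ C k ∧ τ • Q = Q}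
      zero_mem' := ⟨(C k).zero_mem, smul_zero τ⟩
      add_mem' := fun {a b} ha hb ↦ ⟨(C k).add_mem ha.1 hb.1, by rw [smul_add, ha.2, hb.2]⟩
      neg_mem' := fun {a} ha ↦ ⟨(C k).neg_mem ha.1, by rw [smul_neg, ha.2]⟩ }
  have hmemD : ∀ Q, Q ∈ D ↔ Q ∈ C k ∧ τ • Q = Q := fun Q ↦ Iff.rfl
  have hDle : D ≤ C k := fun Q hQ ↦ hQ.1
  haveI : Finite (C k) := hfinC k
  haveI : Finite D := Finite.of_injective (fun x : D ↦ (⟨x.1, hDle x.2⟩ : C k))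
    fun a b h ↦ Subtype.ext (congrArg (fun z : C k ↦ (z : localPoints W E)) h)
  -- `#D = p^j`, `D` is killed by `p^j`, hence `D = C j`
  obtain ⟨j, -, hDcard⟩ : ∃ j ≤ k, Nat.card D = p ^ j :=
    (Nat.dvd_prime_pow hp.out).mp (hcardC k ▸ AddSubgroup.card_dvd_of_le hDle)
  have hDj : D ≤ C j := by
    intro Q hQ
    refine (hmemC j Q).mpr ⟨((hmemC k Q).mp hQ.1).1, ?_⟩
    have h0 : Nat.card D • (⟨Q, hQ⟩ : D) = 0 := card_nsmul_eq_zero'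
    rw [natCast_zsmul, ← hDcard]
    exact congrArg Subtype.val h0
  haveI : Finite (C j) := hfinC j
  have hDeq : D = C j := AddSubgroup.eq_of_le_of_card_ge hDj (by rw [hcardC, hDcard])
  -- the generator of `C j` is `τ`-fixed, so `τ` moves `E[p^j]` inside `ker red₀`
  obtain ⟨P₁, hP₁C, hord₁, -⟩ := hC j
  have hτP₁ : τ • P₁ = P₁ := ((hmemD P₁).mp (hDeq ▸ hP₁C :)).2
  have hfixj : ∀ Q : localPoints W E, ((p ^ j : ℕ) : ℤ) • Q = 0 → red₀ (τ • Q) = red₀ Q := by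
    intro Q hQ
    obtain ⟨d, hd⟩ := W.localPoints_exists_nsmul_smul_sub_eq_nsmul E hord₁ (hτfix j) (b := 1)
      (by rw [one_smul]; exact hτP₁) Q hQ
    rw [one_smul] at hd
    have h := congrArg red₀ hd
    rw [map_sub, map_nsmul, ((hmemC j P₁).mp hP₁C).1, smul_zero, sub_eq_zero] at h
    exact h
  -- counting: `#B[p^j] = p^j` and `B[p^j] ⊆ SF`
  have hsurj' : ∀ y ∈ B[(p ^ j : ℕ)], ∃ x ∈ (localPoints W E)[(p ^ j : ℕ)], red₀ x = y := by
    intro y hy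
    obtain ⟨x, hx, hxy⟩ := hsurj j y (mem_torsionBy_iff.mp hy)
    exact ⟨x, mem_torsionBy_iff.mpr hx, hxy⟩
  have hmul := TateModule.card_ker_torsionBy_mul_card red₀ (p ^ j) hsurj'
  have hA : Nat.card ((localPoints W E)[(p ^ j : ℕ)]) = p ^ j * p ^ j := by
    have h := card_torsionBy_eq_sq (E := W.baseChange (AlgebraicClosure E)) (n := p ^ j)
      (by exact_mod_cast hpr j)
    rw [sq] at h
    exact h
  have hker : Nat.card ((red₀.ker)[(p ^ j : ℕ)]) = p ^ j := by
    refine Eq.trans (Nat.card_congr (⟨fun x ↦ ⟨((x : red₀.ker) : localPoints W E),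
      (hmemC j _).mpr ⟨(x : red₀.ker).2, ?_⟩⟩, fun y ↦ ⟨⟨(y : localPoints W E),
        ((hmemC j _).mp y.2).1⟩, ?_⟩, fun x ↦ rfl, fun y ↦ rfl⟩ :
      (red₀.ker)[(p ^ j : ℕ)] ≃ C j)) (hcardC j)
    · exact congrArg Subtype.val (mem_torsionBy_iff.mp x.2)
    · rw [mem_torsionBy_iff]
      apply Subtype.ext
      exact ((hmemC j _).mp y.2).2
  rw [hker, hA] at hmul
  have hBcard : Nat.card (B[(p ^ j : ℕ)]) = p ^ j :=
    Nat.eq_of_mul_eq_mul_left (Nat.pos_of_ne_zero (hpr j)) hmul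
  have hBle : p ^ j ≤ SF.card := by
    rw [← hBcard, ← Nat.card_eq_finsetCard SF]
    refine Nat.card_le_card_of_injective (fun y ↦ (⟨(y : B), ?_⟩ : {b // b ∈ SF})) ?_
    · obtain ⟨x, hx, hxy⟩ := hsurj' y y.2
      rw [← hxy]
      exact hSF x (hfixj x (mem_torsionBy_iff.mp hx))
    · intro a b h
      exact Subtype.ext (congrArg (fun z : {b // b ∈ SF} ↦ (z : B)) h)
  -- the filter injects into `D`
  have hfilter : ((Finset.range (p ^ k)).filter fun i : ℕ ↦ τ • (i • P₀) = i • P₀).card ≤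
      Nat.card D := by
    rw [← Nat.card_eq_finsetCard]
    refine Nat.card_le_card_of_injective (fun i ↦ (⟨(i : ℕ) • P₀, ?_⟩ : D)) ?_
    · obtain ⟨-, hfix⟩ := Finset.mem_filter.mp i.2
      refine ⟨(hmemC k _).mpr ⟨by rw [map_nsmul, hP₀, smul_zero], ?_⟩, hfix⟩
      rw [natCast_zsmul, smul_comm, hpkP₀, smul_zero]
    · intro a b h
      have h' : (a : ℕ) • P₀ = (b : ℕ) • P₀ := congrArg Subtype.val h
      have ha : (a : ℕ) ∈ Set.Iio (addOrderOf P₀) := by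
        rw [Set.mem_Iio, hordP₀]; exact Finset.mem_range.mp (Finset.mem_filter.mp a.2).1
      have hb : (b : ℕ) ∈ Set.Iio (addOrderOf P₀) := by
        rw [Set.mem_Iio, hordP₀]; exact Finset.mem_range.mp (Finset.mem_filter.mp b.2).1
      exact Subtype.ext (nsmul_injOn_Iio_addOrderOf ha hb h')
  calc ((Finset.range (p ^ k)).filter fun i : ℕ ↦ τ • (i • P₀) = i • P₀).card
      ≤ Nat.card D := hfilter
    _ = p ^ j := hDcard
    _ ≤ SF.card := hBle

end Fixed

/-! ## (C1) at a good ordinary prime -/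

section Count

variable {K : Type u} [Field K] [NumberField K] {v : HeightOneSpectrum (𝓞 K)}
  {w : Valuation (AlgebraicClosure (v.adicCompletion K)) ℝ≥0}
  (hw : ∀ x, (w x : ℝ) = spectralNorm (v.adicCompletion K) (AlgebraicClosure (v.adicCompletion K)) x)
  {𝔐 : Ideal v.localAbsIntegers} (h𝔐 : 𝔐 ∈ v.localPrimesAbove)
  {p : ℕ} [hp : Fact p.Prime] (hpv : (p : 𝓞 K) ∈ v.asIdeal)
  (hϖ : Irreducible ((p : ℕ) : v.adicCompletionIntegers K))
  (W : WeierstrassCurve K) [W.IsElliptic]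
  {B : Type*} [AddCommGroup B] (red₀ : localPoints W (v.adicCompletion K) →+ B)
  (hstab : ∀ (σ : absoluteGaloisGroup (v.adicCompletion K)) (Q : localPoints W (v.adicCompletion K)),
    red₀ Q = 0 → red₀ (σ • Q) = 0)
  {τ : absoluteGaloisGroup (v.adicCompletion K)}
  (hτ : IsArithFrobAt (v.adicCompletionIntegers K) τ 𝔐)
  (hτfix : ∀ (k : ℕ) (ξ : AlgebraicClosure (v.adicCompletion K)), ξ ^ p ^ k = 1 → τ • ξ = ξ)
  (hgenr : ∀ r : ℕ, ∃ P₁ : localPoints W (v.adicCompletion K), red₀ P₁ = 0 ∧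
    addOrderOf P₁ = p ^ r ∧ ∀ P : localPoints W (v.adicCompletion K), red₀ P = 0 →
      ((p ^ r : ℕ) : ℤ) • P = 0 → ∃ c : ℕ, P = c • P₁)
  (hsurj : ∀ (r : ℕ) (y : B), ((p ^ r : ℕ) : ℤ) • y = 0 →
    ∃ x : localPoints W (v.adicCompletion K), ((p ^ r : ℕ) : ℤ) • x = 0 ∧ red₀ x = y)
  (SF : Finset B)
  (hSF : ∀ Q : localPoints W (v.adicCompletion K), red₀ (τ • Q) = red₀ Q → red₀ Q ∈ SF)
  (hlayer : ∀ F : Finset (localPoints W (v.adicCompletion K)), ∃ f : ℕ, f ≠ 0 ∧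
    ∀ ζL : AlgebraicClosure (v.adicCompletion K),
      IsPrimitiveRoot ζL (Nat.card (IsLocalRing.ResidueField (v.adicCompletionIntegers K)) ^ f - 1) →
        ∀ σ : absoluteGaloisGroup (v.adicCompletion K), σ • ζL = ζL →
          ∀ Q ∈ F, red₀ (σ • Q) = red₀ Q)

include hw h𝔐 hpv hϖ hstab hτ hτfix hgenr hsurj hSF hlayer in
set_option maxHeartbeats 1600000 in
/-- **(C1) at a good ordinary prime: the cocycles `Γ_{K_v} → ker red₀ ∩ E[p^k]` fall into at most
`#SF² · q · q^k` classes modulo coboundaries of `p^k`-torsion points** (`q = #k_v`). With `P₀` a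
generator of `ker red₀ ∩ E[p^k]` (order `p^k`), every such cocycle is `ℤP₀`-valued; every
`σ ∈ Γ_{K_v}` acts on `P₀` by a scalar `c(σ)` (`ker red₀ ∩ E[p^k]` is stable); over a Teichmüller
layer `L = K_v(ζ_{q^f-1})` on which the reductions of chosen lifts of `B[p^k]` are fixed
(`hlayer`), every `σ` fixing `L` acts trivially on `E[p^k]/ℤP₀`, so the Weil pairing furnishes a
primitive `p^k`-th root of unity `ζ` with `σζ = ζ^{c(σ)}` (`localPoints_exists_isPrimitiveRoot_smul_eq_pow`);
the arithmetic Frobenius `τ` fixing `μ_{p^∞}` has `τζ = ζ` (`a = 1`), `τP₀ = bP₀`, and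
`e = c(τ⁻¹) ≡ b⁻¹`. Then `exists_finset_cocycle_reps_of_cyclotomicLine` bounds the number of
classes by `N · q^{k+1} · M₀`, where both `N = #{i < p^k : p^k ∣ (e-1)i} = #{i : τ(iP₀) = iP₀}`
and `M₀ ≤ #{i : τ(iP₀) = iP₀}` are `≤ #SF` (`card_filter_smul_nsmul_eq_le`). Greenberg, LNM 1716,
§2 Prop. 2.2 (p. 73: "`H¹(M_η, C)` has `ℤ_p`-corank `[M_η : ℚ_p]`") and §3 Lemma 3.4 (p. 89).
[cite: GreenbergLNM1716, §3 Lemma 3.4 (p. 89)] [cite: GreenbergLNM1716, §2 Prop. 2.2 (p. 73)] -/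
theorem exists_finset_cocycle_reps_of_ordinaryLine (k : ℕ) :
    ∃ S : Finset (contOneCocycles (discreteTopRep (absoluteGaloisGroup (v.adicCompletion K))
      (localPoints W (v.adicCompletion K)))),
      S.card ≤ SF.card * SF.card * Nat.card (IsLocalRing.ResidueField (v.adicCompletionIntegers K)) *
        Nat.card (IsLocalRing.ResidueField (v.adicCompletionIntegers K)) ^ k ∧
      ∀ ψ : contOneCocycles (discreteTopRep (absoluteGaloisGroup (v.adicCompletion K))
        (localPoints W (v.adicCompletion K))),
        (∀ g, p ^ k • ψ.1 g = 0) → (∀ g, red₀ (ψ.1 g) = 0) →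
          ∃ ψ₀ ∈ S, ∃ t : localPoints W (v.adicCompletion K), p ^ k • t = 0 ∧
            ∀ g, ψ.1 g - ψ₀.1 g = g • t - t := by
  haveI : CharZero (v.adicCompletion K) :=
    charZero_of_injective_algebraMap (algebraMap K (v.adicCompletion K)).injective
  haveI : CharZero (AlgebraicClosure (v.adicCompletion K)) := charZero_of_injective_algebraMap
    (algebraMap (v.adicCompletion K) (AlgebraicClosure (v.adicCompletion K))).injective
  have hpk : p ^ k ≠ 0 := pow_ne_zero k hp.out.ne_zero
  -- the generator `P₀` of `ker red₀ ∩ E[p^k]`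
  obtain ⟨P₀, hP₀, hordP₀, hgen₀⟩ := hgenr k
  have hP₀Z : ∀ m : ℤ, m • P₀ = 0 ↔ ((p ^ k : ℕ) : ℤ) ∣ m := fun m ↦ by
    rw [← addOrderOf_dvd_iff_zsmul_eq_zero, hordP₀]
  have hpkP₀ : (p ^ k) • P₀ = 0 := by rw [← hordP₀]; exact addOrderOf_nsmul_eq_zero P₀
  -- every `σ` acts on `P₀` by a scalar `c σ`
  have hscal : ∀ σ : absoluteGaloisGroup (v.adicCompletion K), ∃ c : ℕ, σ • P₀ = c • P₀ :=
    fun σ ↦ hgen₀ (σ • P₀) (hstab σ P₀ hP₀)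
      (by rw [natCast_zsmul, smul_comm, hpkP₀, smul_zero])
  choose c hc using hscal
  -- `e = c τ⁻¹` is inverse to `b = c τ` modulo `p^k`
  have he : ((p ^ k : ℕ) : ℤ) ∣ ((c τ⁻¹ * c τ : ℕ) : ℤ) - ((1 : ℕ) : ℤ) := by
    rw [← IsDedekindDomain.HeightOneSpectrum.nsmul_eq_nsmul_iff_dvd_sub hP₀Z]
    rw [one_smul, mul_comm, mul_smul, ← hc τ⁻¹, smul_comm (c τ) τ⁻¹ P₀, ← hc τ, inv_smul_smul]
  -- lifts of `B[p^k]` and the Teichmüller layer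
  have hsurjk : ∀ y ∈ B[(p ^ k : ℕ)], ∃ x ∈ (localPoints W (v.adicCompletion K))[(p ^ k : ℕ)],
      red₀ x = y := by
    intro y hy
    obtain ⟨x, hx, hxy⟩ := hsurj k y (mem_torsionBy_iff.mp hy)
    exact ⟨x, mem_torsionBy_iff.mpr hx, hxy⟩
  haveI : Finite (B[(p ^ k : ℕ)]) := by
    have hmul := TateModule.card_ker_torsionBy_mul_card red₀ (p ^ k) hsurjk
    have hA : Nat.card ((localPoints W (v.adicCompletion K))[(p ^ k : ℕ)]) = (p ^ k) ^ 2 :=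
      card_torsionBy_eq_sq (E := W.baseChange (AlgebraicClosure (v.adicCompletion K)))
        (n := p ^ k) (by exact_mod_cast hpk)
    refine Nat.finite_of_card_ne_zero fun h0 ↦ ?_
    rw [h0, mul_zero, hA] at hmul
    exact pow_ne_zero 2 hpk hmul.symm
  haveI : Fintype (B[(p ^ k : ℕ)]) := Fintype.ofFinite _
  choose lift hlift₁ hlift₂ using hsurj k
  set F : Finset (localPoints W (v.adicCompletion K)) :=
    Finset.univ.image fun y : B[(p ^ k : ℕ)] ↦ lift (y : B) (mem_torsionBy_iff.mp y.2) with hFdef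
  obtain ⟨f, hf, hF⟩ := hlayer F
  -- a primitive `(q^f - 1)`-th root of unity
  have hm0 : Nat.card (IsLocalRing.ResidueField (v.adicCompletionIntegers K)) ^ f - 1 ≠ 0 :=
    IsDedekindDomain.HeightOneSpectrum.residueCard_pow_sub_one_ne_zero (v := v) hf
  haveI : NeZero ((Nat.card (IsLocalRing.ResidueField (v.adicCompletionIntegers K)) ^ f - 1 : ℕ) :
      AlgebraicClosure (v.adicCompletion K)) := ⟨by exact_mod_cast hm0⟩
  obtain ⟨ζL, hζL⟩ := HasEnoughRootsOfUnity.exists_primitiveRoot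
    (AlgebraicClosure (v.adicCompletion K))
    (Nat.card (IsLocalRing.ResidueField (v.adicCompletionIntegers K)) ^ f - 1)
  -- over the layer, every `σ` acts trivially on `E[p^k]/ℤP₀`
  have h2 : ∀ σ ∈ {σ : absoluteGaloisGroup (v.adicCompletion K) | σ • ζL = ζL},
      ∀ Q : localPoints W (v.adicCompletion K), ((p ^ k : ℕ) : ℤ) • Q = 0 →
        ∃ d : ℕ, σ • Q - (fun _ : absoluteGaloisGroup (v.adicCompletion K) ↦ (1 : ℕ)) σ • Q =
          d • P₀ := by
    intro σ hσ Q hQ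
    have hy : ((p ^ k : ℕ) : ℤ) • red₀ Q = 0 := by rw [← map_zsmul, hQ, map_zero]
    have hx : ((p ^ k : ℕ) : ℤ) • lift (red₀ Q) hy = 0 := hlift₁ _ hy
    have hxy : red₀ (lift (red₀ Q) hy) = red₀ Q := hlift₂ _ hy
    have hxF : lift (red₀ Q) hy ∈ F :=
      Finset.mem_image.mpr ⟨⟨red₀ Q, mem_torsionBy_iff.mpr hy⟩, Finset.mem_univ _, rfl⟩
    -- `Q - x ∈ ℤP₀` and `σx - x ∈ ℤP₀`
    obtain ⟨d₁, hd₁⟩ := hgen₀ (Q - lift (red₀ Q) hy) (by rw [map_sub, hxy, sub_self])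
      (by rw [smul_sub, hQ, hx, sub_self])
    obtain ⟨d₂, hd₂⟩ := hgen₀ (σ • lift (red₀ Q) hy - lift (red₀ Q) hy)
      (by rw [map_sub, hF ζL hζL σ hσ _ hxF, sub_self])
      (by rw [smul_sub, natCast_zsmul, natCast_zsmul, smul_comm, ← natCast_zsmul, hx, smul_zero,
        sub_self])
    obtain ⟨d₃, hd₃⟩ :=
      IsDedekindDomain.HeightOneSpectrum.exists_nsmul_eq_sub hP₀Z hpk (d₁ * c σ) d₁
    refine ⟨d₃ + d₂, ?_⟩
    have e1 : σ • Q - (1 : ℕ) • Q =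
        σ • (Q - lift (red₀ Q) hy) - (Q - lift (red₀ Q) hy) +
          (σ • lift (red₀ Q) hy - lift (red₀ Q) hy) := by
      rw [one_smul, smul_sub]; abel
    rw [e1, hd₂, hd₁, smul_comm σ d₁ P₀, hc σ, ← mul_smul, add_smul, ← hd₃]
  have h1 : ∀ σ ∈ {σ : absoluteGaloisGroup (v.adicCompletion K) | σ • ζL = ζL},
      σ • P₀ = c σ • P₀ := fun σ _ ↦ hc σ
  obtain ⟨ζ, hζ, hζσ⟩ := W.localPoints_exists_isPrimitiveRoot_smul_eq_pow (v.adicCompletion K)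
    hordP₀ {σ | σ • ζL = ζL} c (fun _ ↦ 1) h1 h2
  have hN' : ∀ σ : absoluteGaloisGroup (v.adicCompletion K), σ • ζL = ζL →
      ∃ c' : ℕ, σ • P₀ = c' • P₀ ∧ σ • ζ = ζ ^ c' :=
    fun σ hσ ↦ ⟨c σ, hc σ, by rw [hζσ σ hσ, one_mul]⟩
  have ha : τ • ζ = ζ ^ (1 : ℕ) := by rw [pow_one]; exact hτfix k ζ hζ.pow_eq_one
  have hb : τ • P₀ = c τ • P₀ := hc τ
  -- the count over the cyclotomic line
  obtain ⟨S, hScard, hSrep⟩ :=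
    IsDedekindDomain.HeightOneSpectrum.exists_finset_cocycle_reps_of_cyclotomicLine hw h𝔐 hpv hϖ
      hτ hf hζL (continuous_smul_localPoints W (v.adicCompletion K)) hP₀Z hζ hN' ha hb he
  -- both constants are bounded by `#SF`
  have hF1 := W.card_filter_smul_nsmul_eq_le (v.adicCompletion K) red₀ hτfix hgenr hsurj SF hSF
    hP₀ hordP₀
  have hN : ((Finset.range (p ^ k)).filter fun i : ℕ ↦
      ((p ^ k : ℕ) : ℤ) ∣ (((c τ⁻¹ : ℕ) : ℤ) - 1) * i).card ≤ SF.card := by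
    refine le_trans (Finset.card_le_card fun i hi ↦ ?_) hF1
    rw [Finset.mem_filter] at hi ⊢
    refine ⟨hi.1, ?_⟩
    rw [smul_comm τ i P₀, hc τ, ← mul_smul,
      IsDedekindDomain.HeightOneSpectrum.nsmul_eq_nsmul_iff_dvd_sub hP₀Z]
    obtain ⟨c₁, hc₁⟩ := he
    obtain ⟨c₂, hc₂⟩ := hi.2
    push_cast at hc₁ hc₂ ⊢
    exact ⟨(i : ℤ) * c₁ - (c τ : ℤ) * c₂, by linear_combination (i : ℤ) * hc₁ - (c τ : ℤ) * hc₂⟩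
  have hM₀ : ((Finset.range (p ^ k)).filter fun i : ℕ ↦
      ∀ σ : absoluteGaloisGroup (v.adicCompletion K), σ • (i • P₀) = i • P₀).card ≤ SF.card := by
    refine le_trans (Finset.card_le_card fun i hi ↦ ?_) hF1
    rw [Finset.mem_filter] at hi ⊢
    exact ⟨hi.1, hi.2 τ⟩
  refine ⟨S, ?_, fun ψ hψp hψr ↦ hSrep ψ fun g ↦ hgen₀ (ψ.1 g) (hψr g)
    (by rw [natCast_zsmul]; exact hψp g)⟩
  calc S.card ≤ _ := hScard
    _ ≤ SF.card * Nat.card (IsLocalRing.ResidueField (v.adicCompletionIntegers K)) ^ (k + 1) *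
        SF.card := Nat.mul_le_mul (Nat.mul_le_mul_right _ hN) hM₀
    _ = SF.card * SF.card * Nat.card (IsLocalRing.ResidueField (v.adicCompletionIntegers K)) *
        Nat.card (IsLocalRing.ResidueField (v.adicCompletionIntegers K)) ^ k := by ring

end Count

end WeierstrassCurve
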